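/-
Copyright (c) 2026 the pub-hodgecm-mathlib formalisation cell (harness21).  Prover seat hodgecm-mathlib-K2E1-p11 (g3), Track B ∕ K2-LIT, h413 = `stmt-HodgeConjecture-24833`,
R90-TF section S8 «ContSpec-n½», #2 road (G side), S8 dealer R90-CS-plan (g2) S8-R57 (b) «(3) = β-HULL» (census `R90/S8/CENSUS-GDEFS.K2E1-p11-g3.md` item (3β); token census
2026-09-04T22:42:39Z): the ξ-indexed MIDDLE-POLE RESIDUE ATOM `resGMidAtom ξ μω K′ ω` of `L²(U_{L/L⁺}(3))` on Mok's carrier and its invariant closed hull `resGMidBlock ξ μω` — the carrier of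
B ED. 5's sub-sockets EXH ∕ MID of socket #2.
-/
import Summits.HodgeConjecture.HodgeConjecture.Theorems.K2E1ChiSectionSpaceU3PairDefs   -- ★ p862227 (D-S8-3′): `chiSectionSpacePair χ₁ χ₂ K′ ω` (pair sections, `χ₂` read on the middle entry `b₁₁`)
import Summits.HodgeConjecture.HodgeConjecture.Theorems.K2E1BorelEisensteinUDefs       -- ★ `eisensteinSeriesU`, `flatSectionU` (the family `z ↦ E(φ_z)`)
import Literature.NumberTheory.Rogawski1990.OneDimAutRepH                               -- ★ `OneDimAutRepH` (`ξ = (η, ψ)`), `ξ.bcη`, `ξ.bcψ`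
import Literature.NumberTheory.Automorphic.DiscreteDecompositionCriterion               -- ★ `ContRepresentation.ClosedSubrep.generate` (smallest closed invariant subrepresentation ⊇ a set)
import Literature.NumberTheory.Automorphic.AutomorphicSpectrum                          -- ★ `AdelicGroupData.rightRegular`, `L2`
import Mathlib.Analysis.Analytic.Basic                                                  -- Mathlib `AnalyticAt`
import HarnessLib

/-!
# S8 #2 road (G side) — `R90S8ResGMidAtomU3Defs`: THE MIDDLE-POLE RESIDUE ATOM `resGMidAtom ξ μω K′ ω` AND ITS INVARIANT CLOSED HULL `resGMidBlock ξ μω` ON `U_{L/L⁺}(3) = quasiSplit L⁺ L c 3`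
# (β-HULL, S8-R57 (b)): the closed span of the `L²` classes that are a.e. a POLE-LETTER VALUE AT `z₀ = 3/2` of THE continued Eisenstein family of a section of the `φ_ξ`-block

Track B ∕ K2-LIT, crux h413 = `stmt-HodgeConjecture-24833`, route of record `HCCMUnconditional`; cell `hodgecm-mathlib`, R90-TF programme, section S8 «ContSpec-n½», socket #2
`sock_S8_res_classification` (B ED. 4 :205–:214) and its ED. 5 sub-sockets EXH ∕ MID (S8-R51 (c), S8-R57 (b)).  DEFINITIONS FILE (`--kind definition --supports stmt-HodgeConjecture-24833
--as helper`): three `def`s + `rfl`∕`subset`∕`generate_le`-deep read-backs; no `instance`, no `notation`, no named-fact hypothesis, no `sorry`; PRINT currency `quasiSplit L⁺ L c 3` (G-SIDE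
SEAM RULE S8-R51).  CLOSES NO SOCKET; pays no letter; it FIXES THE CARRIER BYTES of EXH («irreducible `P ≤ L²_res` ⇒ `P ≤ closure ((⨆_ψ ℂ·[ψ̄∘det]) ⊔ ⨆_ξ resGMidBlock ξ μω)`» modulo the G-letter
chain) and MID («every irreducible closed `P′ ≤ resGMidBlock ξ μω` has `π_v = πⁿ(ξ_v)` at every finite `v`», the IsPiN body on the print currency = ★ F3's hypothesis body) — texts by R90-CS-typ2.

THE MATHEMATICS ([Rogawski1990] §13.9 (ii) p. 229 «πⁿ(ξ) occurs in the discrete non-cuspidal spectrum if L(½, φ) ≠ 0», §12.2 (3) p. 173, §12.1 p. 171; [MoeglinWaldspurger1995] IV.1.11, V.3.13,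
VI.2; [Langlands1976] §7).  For a one-dimensional automorphic `ξ = (η, ψ)` of `H = U(2) × U(1)` (★ `OneDimAutRepH L`) and Rogawski's auxiliary Hecke character `μ = μω`, the members
`⊗_v πⁿ(ξ_v)` are Langlands quotients of the Borel-induced representation from the torus character `χ_ξ : d(α, β, ᾱ⁻¹) ↦ η(α∕ᾱ)·μ(α)·‖α‖^{1/2} · ψ(det d)` (★ `cmXiTorusChar` = ★ `xiTorusChar …
0 μ η ψ` = ★ `torusCharPair … (η ∘ quotConj · μ · ‖·‖^{1/2}) ψ`, second character READ ON `det d = (α∕ᾱ)·β` — Rogawski §12.1 p. 171).  In the tree's GLOBAL pair-section convention ★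
`IsChiSectionPair χ₁ χ₂` (`χ₁` on `b₀₀ = α`, `χ₂` on the MIDDLE entry `b₁₁ = β`) this is the block **`χ₁ = ξ.bcη⁻¹ * ξ.bcψ⁻¹ * μω`** (`η(α∕ᾱ) = (ξ.bcη α)⁻¹`, `ψ(α∕ᾱ) = (ξ.bcψ α)⁻¹`: ★
`locη`∕`locψ` are the inverses of the local components of `bcη`∕`bcψ`, and ★ `splitν₀ = locη·locψ·μ_w` is exactly `χ₁`'s component at a split place), **`χ₂ = ξ.ψ`**, the modulus `‖α‖^{s}`
being the parameter `z` of ★ `flatSectionU` (E1 normalisation `s = z − 1`: Godement domain `2 < Re z`, the «`s = ½`» pole at **`z₀ = 3/2`**, ★ F5 `K2E1ChiScatteringPoleDichotomyU3`); the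
central value steering the pole is `L(½, φ_ξ)`, `φ_ξ = ξ.bcη⁻¹ * μω` (socket #3's ★ `LHalfNeZero (ξ.bcη⁻¹ * μω)` — the `ψ∘det` twist does not move it).  TOKEN DICTIONARY OF
RECORD (S8-R64 (1), five line anchors): ★ `IsChiSectionPair` (`Theorems/K2E1CharacterEisensteinU3PairDefs` :254, `χ₂` on the middle entry) ⟷ ★ `torusCharPair … χ₁ χ₂ t = χ₁ (t_ii) * χ₂ (det t)`
(`Literature/…/UnitaryGroupBorelInduction` :387–:394), ★ `xiTorusChar` (:445–:448), ★ `cmXiTorusChar` (:595–:599), ★ `locη ∕ locψ ∕ splitν₀` (`Literature/…/Rogawski1990/GlobalAPacketMembership`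
:154–:159, :194–:199): BLOCK hands (MID, (NV), this file) use `(χ₁, χ₂) = (ξ.bcη⁻¹ * ξ.bcψ⁻¹ * μω, ξ.ψ)`; L-VALUE hands (F4∕F5∕B2, #3∕#2♯) use `φ = ξ.bcη⁻¹ * μω` — never cross them.  The residues
`Res_{z = 3/2} E(φ, z)`, `φ ∈ V(χ₁, χ₂; K′, ω)`, span (after closure) the `πⁿ(ξ)`-isotypic residual block; this file DEFINES that span honestly, with NO residue operator: a class `f ∈ L²`
is a generator iff it is a.e. `x ↦ Fp((out x)⁻¹)(3/2)` for a POLE LETTER `Fp` at `z₀ = 3/2` (★ F6 §1 currency: `Fp g` analytic at `z₀` and `= (z − z₀)·Ec z g` on a punctured neighbourhood)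
of a family `Ec` which IS the meromorphic continuation of `z ↦ E(φ_z) = eisensteinSeriesU (flatSectionU φ z)` — continuation clauses INLINED (S8-R57 (b), no new predicate): `Ec · g`
holomorphic on `{1 < Re z} ∖ Sp` for a FINITE set `Sp` of real points of `(1, 2]`, and `Ec z = eisensteinSeriesU (flatSectionU φ z)` for `2 < Re z` (the phrasing of the ★
`K2E1ChiEisensteinMeromorphicExports*CMThree` packages); since `{1 < Re} ∖ Sp` is connected and contains `{2 < Re}`, the identity theorem makes `Ec` — hence `Fp(·)(3/2)` — UNIQUE given
`φ`, so payers plug their exported `Ec` by name.  The hull D3 `resGMidBlock ξ μω := ClosedSubrep.generate R_μ (⋃_{K′, ω} resGMidAtom ξ μω K′ ω)` is the smallest closed `R(G(𝔸))`-invariant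
subspace containing every level's atom (★ `ClosedSubrep.generate`) — F2_qs's `Bn ξ`; the identification «`resGMidAtom` is already invariant» [MW V.3.13] is NOT claimed (M: translation
equivariance of `eisensteinSeriesU` + uniqueness of continuation) and not needed: MID is typed ON THE HULL and EXH's `hle` rides monotonicity (`resGMidAtom_le_resGMidBlock`).
* D1 `resGMidAtomGen ξ μω K' ω : Set (L² μ)` (the generators, all clauses visible) + `mem_resGMidAtomGen_iff` (`Iff.rfl`).
* D2 `resGMidAtom ξ μω K' ω : Submodule ℂ (L² μ)` := `(span (resGMidAtomGen …)).topologicalClosure` + `resGMidAtom_def`, `subset_resGMidAtom`, `span_le_resGMidAtom`, `isClosed_resGMidAtom`.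
* D3 `resGMidBlock ξ μω : ClosedSubrep ((quasiSplit …).rightRegular μ)` (LEVEL-FREE hull, S8-R64) + `resGMidAtom_le_resGMidBlock` (EXH's monotonicity), `resGMidBlock_ne_bot_of_mem` ((NV)-interface),
  `resGMidBlock_le` (minimality: MID's payer may work on any closed invariant `W ⊇` all atoms), `iSup_resGMidAtom_le_iSup_resGMidBlock`.
HONEST LABEL: HC_CM is proved only modulo the 7 printed citations (2 remaining named inputs: hLiu418 = `stmt-HodgeConjecture-24832`, h413 = `stmt-HodgeConjecture-24833`) until
rung 0 closes; REL ≠ ★ ≠ BUILT; definitions pay nothing; the EXH∕MID sockets over these carriers remain XL (Langlands' `L²` exhaustion for `U(2,1)`; local identification of the middle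
residue [§12.2 (3)]); count-neutral.

## References
* [Rogawski1990] J. D. Rogawski, *Automorphic Representations of Unitary Groups in Three Variables* (1990), §12.1 p. 171, §12.2 (3) p. 173, §13.9 (ii) p. 229.
* [MoeglinWaldspurger1995] C. Mœglin, J.-L. Waldspurger, *Spectral Decomposition and Eisenstein Series* (1995), IV.1.11, V.3.13, VI.2.
* [Langlands1976] R. P. Langlands, *On the Functional Equations Satisfied by Eisenstein Series*, LNM 544 (1976), §7.
-/

set_option autoImplicit false
set_option linter.dupNamespace false  -- the mandated namespace `…HodgeConjecture.HodgeConjecture.R90.S8` (LEAD #1 L1) repeats the summit's segment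

noncomputable section

open MeasureTheory Measure Set Filter Topology NumberField
open Literature.NumberTheory.Automorphic Literature.NumberTheory.Automorphic.UnitaryGroup Literature.NumberTheory.GaloisRepresentations AdelicGroupData
open Literature.NumberTheory.Automorphic.Arthur2013.Leaves.TECR Literature.NumberTheory.Rogawski1990
open Summit.HodgeConjecture.HodgeConjecture.Cruxes.H413.K2E1BorelEisensteinU
open Summit.HodgeConjecture.HodgeConjecture.Cruxes.H413.K2E1ChiSectionSpaceU3PairDefs
open ContRepresentation
open scoped ENNReal NNReal

namespace Summit.HodgeConjecture.HodgeConjecture.R90.S8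

variable (L : Type) [Field L] [NumberField L] [IsCMField L]
  (μ : Measure (quasiSplit (↥(maximalRealSubfield L)) L (IsCMField.complexConj L) 3).automorphicQuotient)

/-! ## D1 The generators: `L²` classes that are a.e. a pole-letter value at `z₀ = 3/2` of THE continued Eisenstein family of a section of the `φ_ξ`-block -/

/-- **D1 — THE GENERATORS of the middle-pole residue atom of `ξ` at level `(K′, ω)`**: the classes `f ∈ L²(G(L⁺)∖G(𝔸_{L⁺}), μ)` that are a.e. `x ↦ Fp((out x)⁻¹)(3/2)` where `Fp` is a POLE LETTER
at `z₀ = 3/2` (★ F6 §1 currency) of a family `Ec` which IS the meromorphic continuation (clauses inlined: holomorphic on `{1 < Re} ∖ Sp`, `Sp` a finite set of real points of `(1, 2]`;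
`= eisensteinSeriesU (flatSectionU φ ·)` on `2 < Re`) of the Eisenstein family of a continuous section `φ ∈ V(χ₁, χ₂; K′, ω)` of the `φ_ξ`-BLOCK `χ₁ = ξ.bcη⁻¹ * ξ.bcψ⁻¹ * μω`, `χ₂ = ξ.ψ`
(pair-section convention: `χ₂` on the middle entry). [cite: Rogawski1990, §13.9 p. 229 (ii)] [cite: Rogawski1990, §12.1 p. 171] [cite: MoeglinWaldspurger1995, IV.1.11, V.3.13] -/
def resGMidAtomGen (ξ : OneDimAutRepH L) (μω : HeckeCharacter L)
    (K' : Subgroup (quasiSplit (↥(maximalRealSubfield L)) L (IsCMField.complexConj L) 3).Adelic) (ω : ↥K' →* ℂ) :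
    Set ((quasiSplit (↥(maximalRealSubfield L)) L (IsCMField.complexConj L) 3).L2 μ) :=
  {f | ∃ (φ : (quasiSplit (↥(maximalRealSubfield L)) L (IsCMField.complexConj L) 3).Adelic → ℂ)
      (_ : φ ∈ chiSectionSpacePair (ξ.bcη⁻¹ * ξ.bcψ⁻¹ * μω) ξ.ψ K' (ω : ↥K' → ℂ)) (_ : Continuous φ)
      (Ec : ℂ → (quasiSplit (↥(maximalRealSubfield L)) L (IsCMField.complexConj L) 3).Adelic → ℂ) (Sp : Finset ℂ)
      (_ : ∀ s ∈ Sp, s.im = 0 ∧ 1 < s.re ∧ s.re ≤ 2)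
      (_ : ∀ g, DifferentiableOn ℂ (fun z => Ec z g) ({z : ℂ | 1 < z.re} \ (↑Sp : Set ℂ)))
      (_ : ∀ z : ℂ, 2 < z.re → Ec z = eisensteinSeriesU (flatSectionU φ z))
      (Fp : (quasiSplit (↥(maximalRealSubfield L)) L (IsCMField.complexConj L) 3).Adelic → ℂ → ℂ)
      (_ : ∀ g, AnalyticAt ℂ (Fp g) ((3 : ℂ) / 2))
      (_ : ∀ g, Fp g =ᶠ[𝓝[≠] ((3 : ℂ) / 2)] fun z => (z - (3 : ℂ) / 2) * Ec z g),
      (f : (quasiSplit (↥(maximalRealSubfield L)) L (IsCMField.complexConj L) 3).automorphicQuotient → ℂ) =ᵐ[μ]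
        fun x => Fp (Quotient.out (x : (quasiSplit (↥(maximalRealSubfield L)) L (IsCMField.complexConj L) 3).Adelic ⧸
          (quasiSplit (↥(maximalRealSubfield L)) L (IsCMField.complexConj L) 3).quotientSubgroup))⁻¹ ((3 : ℂ) / 2)}

/-- Membership in the generator set (`Iff.rfl`; the shape a payer's residue lemma targets). [cite: Rogawski1990, §13.9 p. 229 (ii)] [cite: MoeglinWaldspurger1995, IV.1.11] -/
theorem mem_resGMidAtomGen_iff (ξ : OneDimAutRepH L) (μω : HeckeCharacter L)
    (K' : Subgroup (quasiSplit (↥(maximalRealSubfield L)) L (IsCMField.complexConj L) 3).Adelic) (ω : ↥K' →* ℂ)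
    (f : (quasiSplit (↥(maximalRealSubfield L)) L (IsCMField.complexConj L) 3).L2 μ) :
    f ∈ resGMidAtomGen L μ ξ μω K' ω ↔
      ∃ (φ : (quasiSplit (↥(maximalRealSubfield L)) L (IsCMField.complexConj L) 3).Adelic → ℂ)
        (_ : φ ∈ chiSectionSpacePair (ξ.bcη⁻¹ * ξ.bcψ⁻¹ * μω) ξ.ψ K' (ω : ↥K' → ℂ)) (_ : Continuous φ)
        (Ec : ℂ → (quasiSplit (↥(maximalRealSubfield L)) L (IsCMField.complexConj L) 3).Adelic → ℂ) (Sp : Finset ℂ)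
        (_ : ∀ s ∈ Sp, s.im = 0 ∧ 1 < s.re ∧ s.re ≤ 2)
        (_ : ∀ g, DifferentiableOn ℂ (fun z => Ec z g) ({z : ℂ | 1 < z.re} \ (↑Sp : Set ℂ)))
        (_ : ∀ z : ℂ, 2 < z.re → Ec z = eisensteinSeriesU (flatSectionU φ z))
        (Fp : (quasiSplit (↥(maximalRealSubfield L)) L (IsCMField.complexConj L) 3).Adelic → ℂ → ℂ)
        (_ : ∀ g, AnalyticAt ℂ (Fp g) ((3 : ℂ) / 2))
        (_ : ∀ g, Fp g =ᶠ[𝓝[≠] ((3 : ℂ) / 2)] fun z => (z - (3 : ℂ) / 2) * Ec z g),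
        (f : (quasiSplit (↥(maximalRealSubfield L)) L (IsCMField.complexConj L) 3).automorphicQuotient → ℂ) =ᵐ[μ]
          fun x => Fp (Quotient.out (x : (quasiSplit (↥(maximalRealSubfield L)) L (IsCMField.complexConj L) 3).Adelic ⧸
            (quasiSplit (↥(maximalRealSubfield L)) L (IsCMField.complexConj L) 3).quotientSubgroup))⁻¹ ((3 : ℂ) / 2) :=
  Iff.rfl

/-! ## D2 The middle-pole residue atom `resGMidAtom ξ μω K′ ω` — the closed span of the generators -/

/-- **D2 — THE MIDDLE-POLE RESIDUE ATOM of `ξ` at level `(K′, ω)`**: the closed span in `L²` of D1's generators (residue classes at `z₀ = 3/2` of the `φ_ξ`-block's Eisenstein series).  In the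
mathematics: the level-`(K′, ω)` vectors of the residual member `⊗_v πⁿ(ξ_v)` when `L(½, ξ.bcη⁻¹·μω) ≠ 0`, and `⊥` otherwise [§13.9 (ii)]; none of this is claimed here.
[cite: Rogawski1990, §13.9 p. 229 (ii)] [cite: MoeglinWaldspurger1995, V.3.13, VI.2] -/
def resGMidAtom (ξ : OneDimAutRepH L) (μω : HeckeCharacter L)
    (K' : Subgroup (quasiSplit (↥(maximalRealSubfield L)) L (IsCMField.complexConj L) 3).Adelic) (ω : ↥K' →* ℂ) :
    Submodule ℂ ((quasiSplit (↥(maximalRealSubfield L)) L (IsCMField.complexConj L) 3).L2 μ) :=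
  (Submodule.span ℂ (resGMidAtomGen L μ ξ μω K' ω)).topologicalClosure

variable (ξ : OneDimAutRepH L) (μω : HeckeCharacter L)
  (K' : Subgroup (quasiSplit (↥(maximalRealSubfield L)) L (IsCMField.complexConj L) 3).Adelic) (ω : ↥K' →* ℂ)

/-- Read-back: `resGMidAtom` unfolds to the closed span of the generators (`rfl`). [cite: MoeglinWaldspurger1995, VI.2] -/
theorem resGMidAtom_def : resGMidAtom L μ ξ μω K' ω = (Submodule.span ℂ (resGMidAtomGen L μ ξ μω K' ω)).topologicalClosure := rfl

/-- Read-back: the generators lie in the atom. [cite: MoeglinWaldspurger1995, VI.2] -/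
theorem subset_resGMidAtom : resGMidAtomGen L μ ξ μω K' ω ⊆ (resGMidAtom L μ ξ μω K' ω : Set ((quasiSplit (↥(maximalRealSubfield L)) L (IsCMField.complexConj L) 3).L2 μ)) :=
  Submodule.subset_span.trans (Submodule.le_topologicalClosure _)

/-- Read-back: the algebraic span of the generators lies in the atom (the shape a payer's «span of residues» lemma starts from). [cite: MoeglinWaldspurger1995, VI.2] -/
theorem span_le_resGMidAtom : Submodule.span ℂ (resGMidAtomGen L μ ξ μω K' ω) ≤ resGMidAtom L μ ξ μω K' ω :=
  Submodule.le_topologicalClosure _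

/-- Read-back: the atom is closed. [cite: MoeglinWaldspurger1995, VI.2] -/
theorem isClosed_resGMidAtom : IsClosed (resGMidAtom L μ ξ μω K' ω : Set ((quasiSplit (↥(maximalRealSubfield L)) L (IsCMField.complexConj L) 3).L2 μ)) :=
  Submodule.isClosed_topologicalClosure _

/-- Read-back (payer's entry point): an `L²` class with the generator property lies in the atom. [cite: Rogawski1990, §13.9 p. 229 (ii)] -/
theorem mem_resGMidAtom_of_mem_gen {f : (quasiSplit (↥(maximalRealSubfield L)) L (IsCMField.complexConj L) 3).L2 μ} (hf : f ∈ resGMidAtomGen L μ ξ μω K' ω) :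
    f ∈ resGMidAtom L μ ξ μω K' ω :=
  subset_resGMidAtom L μ ξ μω K' ω hf

/-! ## D3 The invariant closed hull `resGMidBlock ξ μω` — F2_qs's `Bn ξ`, the carrier of the MID socket -/

variable [(quasiSplit (↥(maximalRealSubfield L)) L (IsCMField.complexConj L) 3).IsAutomorphicMeasure μ]

/-- **D3 — THE MIDDLE BLOCK OF RECORD `resGMidBlock ξ μω`**: the smallest CLOSED `R(G(𝔸))`-INVARIANT subspace of `L²` containing the middle-pole residue atoms of `ξ` at EVERY level `(K′, ω)`
(★ `ClosedSubrep.generate`) — the `Bn ξ` of ★ F2_qs `isOneDimensional_or_exists_isPiNqs`; the MID socket («every irreducible closed `P′ ≤ resGMidBlock ξ μω` has `π_v = πⁿ(ξ_v)` at every finite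
`v`» [§12.2 (3)]) is typed on it, and EXH's `hle` reaches it by `resGMidAtom_le_resGMidBlock`.  (The atoms' own invariance [MW V.3.13] is not claimed.)
[cite: Rogawski1990, §12.2 (3) p. 173] [cite: Rogawski1990, §13.9 p. 229 (ii)] [cite: MoeglinWaldspurger1995, V.3.13] -/
def resGMidBlock (ξ : OneDimAutRepH L) (μω : HeckeCharacter L) :
    ClosedSubrep ((quasiSplit (↥(maximalRealSubfield L)) L (IsCMField.complexConj L) 3).rightRegular μ) :=
  ClosedSubrep.generate ((quasiSplit (↥(maximalRealSubfield L)) L (IsCMField.complexConj L) 3).rightRegular μ)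
    (⋃ (K' : Subgroup (quasiSplit (↥(maximalRealSubfield L)) L (IsCMField.complexConj L) 3).Adelic) (ω : ↥K' →* ℂ),
      (resGMidAtom L μ ξ μω K' ω : Set ((quasiSplit (↥(maximalRealSubfield L)) L (IsCMField.complexConj L) 3).L2 μ)))

/-- Read-back: `resGMidBlock` unfolds to the generated closed subrepresentation (`rfl`). [cite: MoeglinWaldspurger1995, V.3.13] -/
theorem resGMidBlock_def : resGMidBlock L μ ξ μω =
    ClosedSubrep.generate ((quasiSplit (↥(maximalRealSubfield L)) L (IsCMField.complexConj L) 3).rightRegular μ)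
      (⋃ (K' : Subgroup (quasiSplit (↥(maximalRealSubfield L)) L (IsCMField.complexConj L) 3).Adelic) (ω : ↥K' →* ℂ),
        (resGMidAtom L μ ξ μω K' ω : Set ((quasiSplit (↥(maximalRealSubfield L)) L (IsCMField.complexConj L) 3).L2 μ))) := rfl

/-- **EXH's monotonicity step**: every level's atom lies in the hull — `resGMidAtom ξ μω K′ ω ≤ (resGMidBlock ξ μω).toSubmodule` (★ `ClosedSubrep.subset_generate`).
[cite: MoeglinWaldspurger1995, V.3.13] -/
theorem resGMidAtom_le_resGMidBlock : resGMidAtom L μ ξ μω K' ω ≤ (resGMidBlock L μ ξ μω).toSubmodule := fun _ hf =>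
  ClosedSubrep.subset_generate _ (Set.mem_iUnion.2 ⟨K', Set.mem_iUnion.2 ⟨ω, hf⟩⟩)

/-- A generator lies in the hull. [cite: Rogawski1990, §13.9 p. 229 (ii)] -/
theorem mem_resGMidBlock_of_mem_gen {f : (quasiSplit (↥(maximalRealSubfield L)) L (IsCMField.complexConj L) 3).L2 μ} (hf : f ∈ resGMidAtomGen L μ ξ μω K' ω) :
    f ∈ (resGMidBlock L μ ξ μω).toSubmodule :=
  resGMidAtom_le_resGMidBlock L μ ξ μω K' ω (mem_resGMidAtom_of_mem_gen L μ ξ μω K' ω hf)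

/-- **(NV)-interface — the hull is non-zero as soon as ONE level atom has a non-zero vector** (the shape the (NV) hand `R90S8ResGMidResidueClassNeZeroU3` delivers: a non-zero residue class
in some `resGMidAtom ξ μω K′ ω`). [cite: Rogawski1990, §13.9 p. 229 (ii)] -/
theorem resGMidBlock_ne_bot_of_mem {f : (quasiSplit (↥(maximalRealSubfield L)) L (IsCMField.complexConj L) 3).L2 μ} (hf : f ∈ resGMidAtom L μ ξ μω K' ω) (hf0 : f ≠ 0) :
    (resGMidBlock L μ ξ μω).toSubmodule ≠ ⊥ := fun h =>
  hf0 ((Submodule.mem_bot ℂ).1 (h ▸ resGMidAtom_le_resGMidBlock L μ ξ μω K' ω hf))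

/-- **Minimality of the hull**: any closed invariant subspace containing every level's atom contains `resGMidBlock ξ μω` (★ `ClosedSubrep.generate_le`) — the MID payer may establish the
`πⁿ(ξ)`-label on any such `W` of his choosing and transport. [cite: MoeglinWaldspurger1995, V.3.13] -/
theorem resGMidBlock_le (W : ClosedSubrep ((quasiSplit (↥(maximalRealSubfield L)) L (IsCMField.complexConj L) 3).rightRegular μ))
    (hW : ∀ (K' : Subgroup (quasiSplit (↥(maximalRealSubfield L)) L (IsCMField.complexConj L) 3).Adelic) (ω : ↥K' →* ℂ), resGMidAtom L μ ξ μω K' ω ≤ W.toSubmodule) :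
    resGMidBlock L μ ξ μω ≤ W :=
  ClosedSubrep.generate_le (Set.iUnion_subset fun K' => Set.iUnion_subset fun ω => hW K' ω)

/-- **EXH's target enlargement, family form**: `⨆_ξ resGMidAtom ξ μω K′ ω ≤ ⨆_ξ (resGMidBlock ξ μω).toSubmodule` — so ★ F1_qs's conclusion with `Bn := resGMidAtom` at one level feeds ★ F2_qs
with `Bn := resGMidBlock` through ★ `residualG_le_topologicalClosure_of_letters_mono`-type monotonicity. [cite: MoeglinWaldspurger1995, V.3.13] -/
theorem iSup_resGMidAtom_le_iSup_resGMidBlock {κ : Type*} (ξs : κ → OneDimAutRepH L) :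
    ⨆ k, resGMidAtom L μ (ξs k) μω K' ω ≤ ⨆ k, (resGMidBlock L μ (ξs k) μω).toSubmodule :=
  iSup_mono fun k => resGMidAtom_le_resGMidBlock L μ (ξs k) μω K' ω

end Summit.HodgeConjecture.HodgeConjecture.R90.S8

end
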